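import Summits.Ventures.PercRepro.Night2OneFatColumnZeroTwo

/-!
# PercRepro — a missed-point target of a lossy big pair without good points has TWO coloops (night-2, gen 29)

`exists_mem_coloops_of_missedTarget` gives one coloop; the same argument gives two: a missed point `x` that is not good
lies in the closures of two distinct faces `Q ∖ w₁ ≠ Q ∖ w₂`, and both `w₁, w₂` stay coloops of `(Q ∪ {x}) ∖ K`.  Hence
the missed-point fallback of `dshGT` never loads a target with at most one coloop off `K` — at a one-coloop target the
load of `dshGT` is the good-source load alone (the case-1 assembly, proofs/NIGHT-2-g29.md §4‴ (iv)).

* **`two_le_card_coloops_of_missedTarget`**.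
-/

namespace PercRepro.Shadow

open Finset PerFlat ThmH

variable {α : Type*} [DecidableEq α] {M : Matroid α} [M.Finite] {G : Finset α}

section MissedTwo

open scoped Classical in
/-- **A missed-point target of a lossy big pair without good points has at least two coloops off `K`.** -/
theorem two_le_card_coloops_of_missedTarget (hG : G ∈ flatsQ M (5 + 1)) (hd : (gr M \ G).card = 2)
    (hk : kColoops M G = 1) (hs : ∀ e ∈ gr M, ∀ f ∈ gr M, e ≠ f → rkN M {e, f} = 2)
    (hl : ∀ e ∈ gr M, M.Indep {e}) {B : Finset α} (hB : B ∈ thinMembers M 5 G)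
    (hbig : 5 ≤ (B \ coloops M G).card) {z : α} (hz : z ∈ G \ clF M B) (hl0 : loss M 5 G B z ≠ 0)
    (hno : ¬ (gtPts M 5 G (insert z B)).Nonempty) {S : Finset α} (hS : S ∈ missedTargets M G B z) :
    2 ≤ (coloops M (S \ coloops M G)).card := by
  have hd' : (gr M \ G).card ≤ 5 := by omega
  obtain ⟨hC3, hImg, -, -⟩ := three_thin_faces_of_loss_ne_zero hG hd hk hs hl hB hbig hz hl0
  set Q := insert z B with hQ
  have hB' : B ∈ membersIn M (Uq M (5 + 2) 5) G := (mem_thinMembers.1 hB).1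
  have hBU : B ∈ Uq M (5 + 2) 5 := (mem_membersIn.1 hB').1
  have hBg : B ⊆ gr M := (mem_Uq.1 hBU).1
  have hBG : B ⊆ G := (subset_clF hBU).trans (mem_membersIn.1 hB').2
  have hQG : Q ⊆ G := Finset.insert_subset (Finset.mem_sdiff.1 hz).1 hBG
  have hQ5 : rkN M (Q \ coloops M G) = 5 := rkN_insert_sdiff_coloops_eq_five_of_thin hG hd hk hB hz
  have hKB : coloops M G ⊆ B := coloops_subset_of_mem_thinMembers hG hd' hB
  obtain ⟨x, hx, hxz, rfl⟩ := mem_missedTargets.1 hS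
  have hxQ : x ∉ Q := by
    rw [hQ, Finset.mem_insert, not_or]
    exact ⟨hxz, notMem_of_mem_sdiff_clF' hBg hx⟩
  have hxG : x ∈ G \ Q := Finset.mem_sdiff.2 ⟨(Finset.mem_sdiff.1 hx).1, hxQ⟩
  have hxK : x ∈ G \ coloops M G := by
    refine Finset.mem_sdiff.2 ⟨(Finset.mem_sdiff.1 hx).1, fun h => hxQ ?_⟩
    exact Finset.mem_insert_of_mem (hKB h)
  have hnotgood : ¬ ((thinFacesOf M 5 G Q).filter (fun F => x ∈ clF M F)).card ≤ 1 := by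
    intro h1
    exact hno ⟨x, mem_goodPts.2 ⟨hxG, h1⟩⟩
  push Not at hnotgood
  unfold thinFacesOf at hnotgood
  rw [hImg] at hnotgood
  obtain ⟨F₁, hF₁, F₂, hF₂, hF12⟩ := Finset.one_lt_card.1 hnotgood
  rw [Finset.mem_filter, Finset.mem_image] at hF₁ hF₂
  obtain ⟨⟨w₁, hw₁, rfl⟩, hx₁⟩ := hF₁
  obtain ⟨⟨w₂, hw₂, rfl⟩, hx₂⟩ := hF₂
  have hw12 : w₁ ≠ w₂ := fun h => hF12 (by rw [h])
  have hthin : ∀ w ∈ coloops M (Q \ coloops M G), Q.erase w ∈ thinMembers M 5 G := by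
    intro w hw
    have : Q.erase w ∈ (coverPreimages M (Uq M (5 + 2) 5) G Q).filter (fun F => F ∉ lay0 M 5 G) := by
      rw [hImg, Finset.mem_image]; exact ⟨w, hw, rfl⟩
    rw [Finset.mem_filter, mem_coverPreimages] at this
    exact mem_thinMembers.2 ⟨this.1.1, this.2⟩
  have hc₁ := mem_coloops_insert_of_mem_clF hG hd hk hQG hQ5 hw₁ (hthin w₁ hw₁) hxK hxQ hx₁
  have hc₂ := mem_coloops_insert_of_mem_clF hG hd hk hQG hQ5 hw₂ (hthin w₂ hw₂) hxK hxQ hx₂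
  have hsub : ({w₁, w₂} : Finset α) ⊆ coloops M (insert x Q \ coloops M G) := by
    intro a ha
    rw [Finset.mem_insert, Finset.mem_singleton] at ha
    rcases ha with rfl | rfl
    · exact hc₁
    · exact hc₂
  have := Finset.card_le_card hsub
  rw [Finset.card_pair hw12] at this
  exact this

end MissedTwo

end PercRepro.Shadow
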